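import Summits.BirchSwinnertonDyer.BirchSwinnertonDyer.Theorems.EisensteinPrimesGoodLatticeResidualPairScalarsAtMultiplicative
import Summits.BirchSwinnertonDyer.BirchSwinnertonDyer.Theorems.ByReductionTypeAtTwoMultTransportFrobenius
import HarnessLib

/-!
# The residual pair of the good lattice at a Frobenius above a multiplicative `ℓ ≠ p`, EVERY prime `ℓ`
# (the non-split `ℓ = 2` gap closed): scalars `{a_ℓ·ℓ, a_ℓ}`

Cell `bsd-eis`, width seat `bsd-line-x1-p1-w2` gen 24, crux 2 `GoodLatticeBDPValue` (stmt-BirchSwinnertonDyer-19032), line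
`halves` v33N; helper `--supports`, closes no stub. PROVED, no named fact, no `sorry`.

WHY. The (eq:Euler-comp) step of Castella–Grossi–Lee–Skinner's proof of Thm. 2.2.2 (held text paper:arxiv-2008.02571
p. 12 L104–121) evaluates, at EVERY multiplicative `ℓ ∥ N`, the residual characters through `{φ(ℓ), ψ(ℓ)} = {a_ℓ ℓ, a_ℓ}`
(Tate curve; Greenberg–Vatsal §2 pp. 14–15). Width seat -w2 gen 23 landed this for the residual pair of the CONTENT stub
3a-A over `K` (`…Theorems.GoodLatticeResidualPairScalarsAtMultiplicative.residualPair_frob_scalars_of_hasMultiplicativeReductionAtPrime`)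
with the NON-SPLIT case restricted to ODD `ℓ` — the restriction of x2-p1-w7's engine, whose only use of `ℓ ≠ 2` is the
Frobenius flip of `√γ` by Euler's criterion (`GreenbergVatsalTateFrobeniusSign.frob_apply_sqrt_gamma_ne`). Curves with
NON-split multiplicative reduction at `2` are INSIDE the content stub's hypotheses (`N_E` even is allowed: (Heeg) only asks
`2` to split in `K`, i.e. `D_K ≡ 1 (mod 8)`, odd; e.g. the isogeny class 14a at `p = 3`: `a_2 = −1`, `a_3 = −2 ≡ 1`), so the
`Σ_{w ∈ Sf}` of 3a-A needs the `ℓ = 2` summand too. At `ℓ = 2` the flip is the tree theorem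
`MultTransportAtTwo.frob_apply_sqrt_gamma_ne_two` (cell bsd-2adic; node-tangent quadratic in place of Euler's criterion;
same binders) — exactly the substitution width seat -w6 gen 8 made for the Dirichlet-presented characters
(`EisensteinPrimesLineCharactersAtMultiplicativePlace.lineChars_natCast_of_not_hasSplitMultiplicativeReductionAtPrime'`).

* §1 **`exists_frob_lineScalars_of_not_hasSplitMultiplicativeReductionAtPrime'`** — x2-p1-w7's engine in -w2 g23's scalar
  form at a NON-split multiplicative `ℓ ≠ p`, EVERY prime `ℓ`: `∃ 𝔓 ∣ (ℓ), ∃ σ₁` arithmetic Frobenius at `𝔓` with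
  `(nφ, nψ) ≡ (−ℓ, −1)` or `(−1, −ℓ)` for the scalars of `σ₁` on every rational `p`-line / its quotient (the flip glued:
  odd `ℓ` Euler, `ℓ = 2` node tangent; rest verbatim).
* §2 **`residualPair_frob_scalars_of_lineScalars`** — the `K`-TRANSFER of -w2 g23's §3 made ABSTRACT in the dichotomy: any
  relation `D(n̄φ, n̄ψ)` that some Frobenius `σ₁ ∈ Γ_ℚ` above `ℓ` satisfies on every rational `p`-line holds for the
  scalars `(ā, b̄)` of any arithmetic Frobenius `σ₀ ∈ Γ_K` at `𝔓 ∣ w ∋ ℓ`, `f(w|ℓ) = 1`, on `(θsub, θquot)` (unique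
  `K`-stable line p740559; `res σ₀ = i·gσ₁g⁻¹`, `i` inertial and unipotent on `E[p]`, invisible to both scalar characters).
* §3 **`residualPair_frob_scalars_of_hasMultiplicativeReductionAtPrime'`** — -w2 g23's §3 WITHOUT `ℓ ≠ 2`:
  split ⇒ `(ā, b̄) ∈ {(ℓ, 1), (1, ℓ)}`, non-split ⇒ `(ā, b̄) ∈ {(−ℓ, −1), (−1, −ℓ)}`, every multiplicative `ℓ ≠ p`.

HONEST FRAMING: helper lemmas on the tree's own objects (both Tate uniformisation facts and both flips are tree THEOREMS);
0 stubs / cells / labels / tiers move; orphan for -19032 until a CGLS-2.2.1-shaped typing of 3a-A consumes it; no summit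
statement, no case of BSD, no crux or stub is proved here.
References: [GreenbergVatsal2000] §2 pp. 14–15; [SilvermanATAEC1994] V.3–V.5; [SilvermanAEC2009] VII.5.1 (b);
[CastellaGrossiLeeSkinner2022] Thm. 2.2.1 / proof of Thm. 2.2.2; [KellerYin2024] §1.4; [NeukirchANT1999] Ch. I §9, §10,
Ch. II §9; [Kriz2016] Thm. 34 (2).
-/

set_option autoImplicit false
set_option linter.dupNamespace false

noncomputable section

open scoped Classical Pointwise

open NumberField IsDedekindDomain Field WeierstrassCurve
  Literature.NumberTheory.EllipticCurves Literature.NumberTheory.GaloisRepresentations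
  Literature.NumberTheory.EllipticCurves.GreenbergSelmer
  Literature.NumberTheory.EllipticCurves.Rank1Residual
  Literature.NumberTheory.EllipticCurves.GreenbergVatsal2000
  Literature.NumberTheory.EllipticCurves.KellerYin2024
  Summit.BirchSwinnertonDyer.Rank1Residual.X2.GreenbergVatsalTateDatum
  Summit.BirchSwinnertonDyer.Rank1Residual.X2.GreenbergVatsalTateDatumSign
  Summit.BirchSwinnertonDyer.Rank1Residual.X2.GreenbergVatsalTateDatumCofree
  Summit.BirchSwinnertonDyer.Rank1Residual.X2.GreenbergVatsalTateFrobeniusSign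
  Summit.BirchSwinnertonDyer.Rank1Residual.X2
  Summit.BirchSwinnertonDyer.BirchSwinnertonDyer.Theorems.EisensteinPrimesLinePsiAtMultiplicativePrime
  Summit.BirchSwinnertonDyer.BirchSwinnertonDyer.Theorems.EisensteinPrimesLinePhiAtMultiplicativePrime
  Summit.BirchSwinnertonDyer.BirchSwinnertonDyer.Theorems.EisensteinPrimesLineCharactersAtMultiplicativePlace
  Summit.BirchSwinnertonDyer.BirchSwinnertonDyer.Theorems.GoodLatticeResidualPairScalarsAtMultiplicative

namespace Summit.BirchSwinnertonDyer.BirchSwinnertonDyer.Theorems.GoodLatticeResidualPairScalarsAtMultiplicativeAll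

variable {p : ℕ} [hp : Fact p.Prime]

/-! ## §1 The scalar dichotomy at a NON-split multiplicative `ℓ ≠ p`, every prime `ℓ` -/

section Engine

variable {W : WeierstrassCurve ℚ} [W.IsElliptic]

/-- **NON-SPLIT multiplicative `ℓ ≠ p`, scalar form, EVERY prime `ℓ`: `{nφ, nψ} ≡ {−ℓ, −1}`.** For `W/ℚ` globally minimal
with non-split multiplicative reduction at the prime `ℓ ≠ p` (place `v = (ℓ)`), there are a prime `𝔓 ∣ v` of `\bar ℤ` and an
arithmetic Frobenius `σ₁` at `𝔓` such that for every rational `p`-line `Φ₀` and all integers `nφ, nψ` with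
`σ₁ • P = nφ • P` on `Φ₀` and `σ₁ • Q − nψ • Q ∈ Φ₀` on `E[p]`: `(nφ, nψ) ≡ (−ℓ, −1)` or `(−1, −ℓ)` mod `p`. The statement of
-w2 g23's `LineScalarsAtMultiplicativePlace.exists_frob_lineScalars_of_not_hasSplitMultiplicativeReductionAtPrime` WITHOUT
`ℓ ≠ 2`; same proof (x2-p1-w7's engine: twisted Tate uniformisation, a local Frobenius flips `√γ`), the flip being Euler's
criterion at odd `ℓ` (`frob_apply_sqrt_gamma_ne`) and the node-tangent quadratic at `ℓ = 2`
(`MultTransportAtTwo.frob_apply_sqrt_gamma_ne_two`). [cite: GreenbergVatsal2000, §2 pp. 14–15]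
[cite: SilvermanATAEC1994, Ch. V Lemma 5.2 (c), Thm. 5.3 (a),(b), Cor. 5.4, Ex. 5.11 (b)]
[cite: SilvermanAEC2009, VII.5 Prop. 5.1(b)] [cite: NeukirchANT1999, Ch. I §10 (10.3) and Ch. II §9 Prop. (9.6)]
[cite: Kriz2016, Thm. 34 (2)] -/
theorem exists_frob_lineScalars_of_not_hasSplitMultiplicativeReductionAtPrime' [W.IsGloballyMinimal]
    {v : HeightOneSpectrum (𝓞 ℚ)} {ℓ : ℕ} [hℓ : Fact ℓ.Prime]
    (hv : (Rat.HeightOneSpectrum.primesEquiv v : ℕ) = ℓ) (hℓp : ℓ ≠ p)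
    (hmult : W.HasMultiplicativeReductionAtPrime ℓ) (hns : ¬ W.HasSplitMultiplicativeReductionAtPrime ℓ) :
    ∃ 𝔓 ∈ v.primesAbove, ∃ σ₁ : absoluteGaloisGroup ℚ, IsArithFrobAt (𝓞 ℚ) σ₁ 𝔓 ∧
      ∀ {Φ₀ : AddSubgroup (geomTorsion W (p : ℤ))}, IsRationalLine W p Φ₀ →
      ∀ {nφ nψ : ℕ}, (∀ P ∈ Φ₀, σ₁ • P = nφ • P) →
        (∀ Q : geomTorsion W (p : ℤ), σ₁ • Q - nψ • Q ∈ Φ₀) →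
        ((nφ : ZMod p) = -(ℓ : ZMod p) ∧ (nψ : ZMod p) = -1) ∨
          ((nφ : ZMod p) = -1 ∧ (nψ : ZMod p) = -(ℓ : ZMod p)) := by
  -- adapted from -w2 g23's `exists_frob_lineScalars_of_not_hasSplitMultiplicativeReductionAtPrime` (odd `ℓ`)
  have hpp := hp.out
  have hℓv : ((ℓ : ℕ) : 𝓞 ℚ) ∈ v.asIdeal := natCast_mem_asIdeal_of_primesEquiv_eq hv
  have hmultAt : W.HasMultiplicativeReductionAt v :=
    GreenbergVatsalStrictSelmerMultiplicative.hasMultiplicativeReductionAt_of_mem W ℓ hmult hℓv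
  obtain ⟨𝔐, h𝔐⟩ := v.localPrimesAbove_nonempty
  obtain ⟨τ, hτ⟩ := IsDedekindDomain.HeightOneSpectrum.exists_isArithFrobAt_localAbsIntegers v h𝔐
  obtain ⟨q, t, Ψ, hq0, hq1, ht0, ht2, hsurj, hker, hΨσ, -⟩ :=
    TateCurve.Silverman1994_thmV53_corV54_tateUniformisation_holds W v hmultAt
  have hker' : ∀ u : (AlgebraicClosure (v.adicCompletion ℚ))ˣ, Ψ (Additive.ofMul u) = 0 →
      ∃ a : ℤ, (u : AlgebraicClosure (v.adicCompletion ℚ)) =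
        algebraMap (v.adicCompletion ℚ) (AlgebraicClosure (v.adicCompletion ℚ)) q ^ a :=
    fun u h ↦ (hker u).1 h
  -- the flip of `√γ`: Euler's criterion at odd `ℓ`, the node-tangent quadratic at `ℓ = 2`
  have hflip : Field.absoluteGaloisGroup.toAlgEquiv (v.adicCompletion ℚ) τ t ≠ t := by
    rcases eq_or_ne ℓ 2 with rfl | hℓ2
    · exact MultTransportAtTwo.frob_apply_sqrt_gamma_ne_two W hmult hns hℓv h𝔐 hτ t ht0 ht2
    · exact frob_apply_sqrt_gamma_ne W hℓ2 hmult hns hℓv h𝔐 hτ t ht0 ht2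
  set N := tateDatum W p Ψ (sign_disj W Ψ t hΨσ) with hN
  set Xl := N.plus.comap (AddSubgroup.inclusion (geomTorsion_le_geomPrimaryTorsion W p)) with hXdef
  have hXcard : Nat.card Xl = p := by
    rw [hXdef, TateLineDecomposition.natCard_comap_eq W p N, hN]
    exact natCard_tateDatum_plus_inf_torsionBy W p Ψ _ hq0 hq1 hker'
  set σ₁ : absoluteGaloisGroup ℚ := absGaloisRestrict ℚ (v.adicCompletion ℚ) τ with hσ₁def
  -- the quotient: `σ₁ ≡ −1`
  have hquot : ∀ Q : geomTorsion W (p : ℤ), σ₁ • Q - (-1 : ℤ) • Q ∈ Xl := fun Q ↦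
    TateLineDecomposition.smul_sub_zsmul_mem_comap W p N (g := σ₁) (s := -1) (fun m' ↦ by
      have h := smul_sub_sign_smul_mem W p Ψ t hΨσ hsurj hker' τ m'
      rwa [if_neg hflip] at h) Q
  -- the eigenvector in the Tate line: `σ₁ • P₀ = (−ℓ) • P₀`
  obtain ⟨P₀, hP₀0, hP₀X, hP₀⟩ := exists_mem_tateLine_eigenvector (W := W) hv hℓp h𝔐 hτ hq0 hq1 hker
    (sign_disj W Ψ t hΨσ) (z := -1) (fun u ↦ by rw [hΨσ τ u, if_neg hflip])
  obtain ⟨h𝔓, hfrob⟩ := LineScalarsAtMultiplicativePlace.isArithFrobAt_absGaloisRestrict_primeBelow h𝔐 hτ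
  refine ⟨_, h𝔓, σ₁, hfrob, fun {Φ₀} hΦ {nφ nψ} hφ hψ ↦ ?_⟩
  have key := lineChars_dichotomy hΦ.1 hXcard (fun P hP ↦ hΦ.2 σ₁ P hP) hquot hP₀X hP₀0 hP₀ hφ hψ
  simp only [neg_one_mul, Int.cast_neg, Int.cast_natCast, Int.cast_one] at key
  exact key

end Engine

/-! ## §2 The `K`-transfer, abstract in the dichotomy -/

section Transfer

variable (W : WeierstrassCurve ℚ) [W.IsElliptic] [W.IsGloballyMinimal] (K : Type) [Field K] [NumberField K]
  {S : Set (PadicAlgCl p)}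

/-- **`K`-transfer of a Frobenius relation on the line scalars.** `W/ℚ` globally minimal, `2 < p`, `Red`, `Anom`, (hlat),
`K` imaginary quadratic with `p` split, `(θsub, θquot)` a residual pair of `E[p]` over `K`, `ℓ ≠ p` multiplicative, `w ∋ ℓ`
of residue degree one, `𝔓 ∣ w`, `σ₀ ∈ Γ_K` an arithmetic Frobenius at `𝔓`. If SOME arithmetic Frobenius `σ₁ ∈ Γ_ℚ` at
some prime above `ℓ` satisfies a relation `D(n̄φ, n̄ψ)` for its scalars `(nφ, nψ)` on EVERY rational `p`-line and its
quotient, then the integer scalars `(a, b)` of `σ₀` on `(θsub, θquot)` (`‖θsub(σ₀) − a‖ < 1`, `‖θquot(σ₀) − b‖ < 1`)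
satisfy `D(ā, b̄)`. (-w2 g23's §2 transfer to the rational line; `res σ₀` is a Frobenius at `ι⁻¹𝔓 ∣ ℓ` since `N w = ℓ`;
`res σ₀ = i · gσ₁g⁻¹` with `i` inertial, unipotent on `E[p]` at a multiplicative `ℓ ≠ p`, invisible to both scalar
characters — -w2 g23's §1.) [cite: GreenbergVatsal2000, §2 pp. 14–15] [cite: KellerYin2024, §1.4 display (char to f) (arXiv:2402.12781v2 TeX L1066–1086)]
[cite: SerreInventiones1972, §1.12] [cite: NeukirchANT1999, Ch. I §9] -/
theorem residualPair_frob_scalars_of_lineScalars (hp2 : 2 < p) (hred : Red W p) (hanom : Anom W p)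
    (hlat : ∀ Φ : AddSubgroup (geomTorsion W (p : ℤ)), IsRationalLine W p Φ → ¬ LineUnramifiedAt W p Φ)
    (hK : IsImaginaryQuadratic K) (hHp : SatisfiesHeegnerHypothesis p K)
    {θsub θquot : FramedGaloisRep K (padicCoeffIntegers S) 1} (h : IsResidualPairOver (W.baseChange K) p θsub θquot)
    {ℓ : ℕ} [hℓ : Fact ℓ.Prime] (hℓp : ℓ ≠ p) (hmult : W.HasMultiplicativeReductionAtPrime ℓ)
    {w : HeightOneSpectrum (𝓞 K)} (hw : ((ℓ : ℕ) : 𝓞 K) ∈ w.asIdeal) (hf : w.asIdeal.inertiaDeg (𝓞 ℚ) = 1)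
    {𝔓 : Ideal (absIntegers (𝓞 K) K)} (h𝔓 : 𝔓 ∈ w.primesAbove) {σ₀ : absoluteGaloisGroup K}
    (hσ₀ : IsArithFrobAt (𝓞 K) σ₀ 𝔓) (D : ZMod p → ZMod p → Prop)
    (hD : ∃ 𝔓₁ ∈ (w.under (𝓞 ℚ)).primesAbove, ∃ σ₁ : absoluteGaloisGroup ℚ, IsArithFrobAt (𝓞 ℚ) σ₁ 𝔓₁ ∧
      ∀ {Φ₀ : AddSubgroup (geomTorsion W (p : ℤ))}, IsRationalLine W p Φ₀ →
      ∀ {nφ nψ : ℕ}, (∀ P ∈ Φ₀, σ₁ • P = nφ • P) →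
        (∀ Q : geomTorsion W (p : ℤ), σ₁ • Q - nψ • Q ∈ Φ₀) → D (nφ : ZMod p) (nψ : ZMod p)) :
    ∃ a b : ℤ,
      ‖((entry S θsub σ₀ : padicCoeffIntegers S) : PadicAlgCl p) - (a : PadicAlgCl p)‖ < 1 ∧
      ‖((entry S θquot σ₀ : padicCoeffIntegers S) : PadicAlgCl p) - (b : PadicAlgCl p)‖ < 1 ∧
      D (a : ZMod p) (b : ZMod p) := by
  -- adapted from -w2 g23's `residualPair_frob_scalars_of_hasMultiplicativeReductionAtPrime`, the dichotomy abstracted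
  have hpp := hp.out
  -- the rational line and the transferred scalars of `res σ₀`
  obtain ⟨Φ₀, hΦ₀⟩ := exists_isRationalLine_of_not_irr (W := W) (p := p) hred
  obtain ⟨a, b, ha, hb, haΦ, hbΦ⟩ := residualPair_scalars_transfer W K hp2 hred hanom hlat hK hHp h hΦ₀ σ₀
  refine ⟨a, b, ha, hb, ?_⟩
  -- the place `v ∋ ℓ` of `ℚ` below `w`, multiplicative, `p ∉ v`
  let v : HeightOneSpectrum (𝓞 ℚ) := w.under (𝓞 ℚ)
  have hwv : w.asIdeal.under (𝓞 ℚ) = v.asIdeal := rfl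
  have hℓv : ((ℓ : ℕ) : 𝓞 ℚ) ∈ v.asIdeal := by
    change ((ℓ : ℕ) : 𝓞 ℚ) ∈ w.asIdeal.comap (algebraMap (𝓞 ℚ) (𝓞 K))
    rw [Ideal.mem_comap, map_natCast]; exact hw
  have hmultv : W.HasMultiplicativeReductionAt v :=
    GreenbergVatsalStrictSelmerMultiplicative.hasMultiplicativeReductionAt_of_mem W ℓ hmult hℓv
  have hpv : ((p : ℕ) : 𝓞 ℚ) ∉ v.asIdeal :=
    ResidualPairUnramifiedAtMultiplicative.not_natCast_mem_of_natCast_mem_of_ne hℓ.out hpp hℓp hℓv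
  -- `res σ₀` is an arithmetic Frobenius at `𝔔 = ι⁻¹ 𝔓 ∣ v`
  set 𝔔 : Ideal (absIntegers (𝓞 ℚ) ℚ) := 𝔓.comap (absIntegersMap ℚ K) with h𝔔def
  have h𝔔 : 𝔔 ∈ v.primesAbove := comap_absIntegersMap_mem_primesAbove hwv h𝔓
  have hres : IsArithFrobAt (𝓞 ℚ) (absGaloisRestrict ℚ K σ₀) 𝔔 := by
    rw [HeightOneSpectrum.isArithFrobAt_iff_of_mem_primesAbove h𝔔]
    have hq : w.residueCard = v.residueCard := by
      rw [residueCard_eq_pow_inertiaDeg_of_under_eq hwv, hf, pow_one]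
    rw [← hq, h𝔔def, forall_smul_sub_pow_mem_comap_iff]
    exact (HeightOneSpectrum.isArithFrobAt_iff_of_mem_primesAbove h𝔓 σ₀).mp hσ₀
  -- scalar characters of `Γ_ℚ` on `Φ₀` and on `E[p]/Φ₀`
  set χl := quotActionChar bot_stable hΦ₀.2 (relIndex_bot_line hΦ₀.1) with hχl
  set χq := quotActionChar hΦ₀.2 top_stable (relIndex_line_top hΦ₀.1) with hχq
  obtain ⟨P₁, hP₁Φ, hP₁0⟩ := exists_ne_zero_mem_line (W := W) hΦ₀.1
  obtain ⟨R₁, hR₁Φ⟩ := exists_not_mem_line (W := W) hΦ₀.1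
  have ha' : (a : ZMod p) = ((χl (absGaloisRestrict ℚ K σ₀) : (ZMod p)ˣ) : ZMod p) :=
    intCast_eq_val_quotActionChar bot_stable hΦ₀.2 (relIndex_bot_line hΦ₀.1) hP₁Φ
      (by rwa [AddSubgroup.mem_bot]) _ (fun P hP ↦ by
        rw [AddSubgroup.mem_bot, sub_eq_zero]; exact haΦ P hP)
  have hb' : (b : ZMod p) = ((χq (absGaloisRestrict ℚ K σ₀) : (ZMod p)ˣ) : ZMod p) :=
    intCast_eq_val_quotActionChar hΦ₀.2 top_stable (relIndex_line_top hΦ₀.1) (AddSubgroup.mem_top R₁) hR₁Φ _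
      (fun Q _ ↦ hbΦ Q)
  -- comparison of `res σ₀` with a Frobenius `σ₁` at `𝔓₁ ∣ v`: `res σ₀ = i · g σ₁ g⁻¹`, `i` inertial at `𝔔`
  have compare : ∀ {𝔓₁ : Ideal (absIntegers (𝓞 ℚ) ℚ)}, 𝔓₁ ∈ v.primesAbove → ∀ {σ₁ : absoluteGaloisGroup ℚ},
      IsArithFrobAt (𝓞 ℚ) σ₁ 𝔓₁ →
      χl (absGaloisRestrict ℚ K σ₀) = χl σ₁ ∧ χq (absGaloisRestrict ℚ K σ₀) = χq σ₁ := by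
    intro 𝔓₁ h𝔓₁ σ₁ hσ₁
    obtain ⟨g, hg⟩ := HeightOneSpectrum.exists_smul_eq_of_mem_primesAbove_holds h𝔓₁ h𝔔
    -- `g σ₁ g⁻¹` is a Frobenius at `𝔔 = g • 𝔓₁`
    have hconj : IsArithFrobAt (𝓞 ℚ) (g * σ₁ * g⁻¹) 𝔔 := by
      rw [HeightOneSpectrum.isArithFrobAt_iff_of_mem_primesAbove h𝔔, ← hg]
      exact (Ideal.forall_conj_smul_sub_pow_mem_smul_iff 𝔓₁ g σ₁ _).mpr
        ((HeightOneSpectrum.isArithFrobAt_iff_of_mem_primesAbove h𝔓₁ σ₁).mp hσ₁)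
    -- the inertial discrepancy `i`
    set i : absoluteGaloisGroup ℚ := absGaloisRestrict ℚ K σ₀ * (g * σ₁ * g⁻¹)⁻¹ with hi
    have hiI : i ∈ 𝔔.inertia (absoluteGaloisGroup ℚ) := hres.mul_inv_mem_inertia hconj
    have huni : ∀ Q : geomTorsion W (p : ℤ), i • (i • Q - Q) = i • Q - Q := fun Q ↦
      FullDescentMultiplicativeUnipotentLine.smul_smul_sub_eq_of_mem_inertia_geomTorsion W hmultv hpp hpv h𝔔 hiI Q
    have hfix := smul_eq_of_unipotent_of_mem_line hΦ₀ huni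
    have hl1 : χl i = 1 := quotActionChar_eq_one_of_forall_smul_eq bot_stable hΦ₀.2 (relIndex_bot_line hΦ₀.1) hfix
    have hq1 : χq i = 1 := quotActionChar_eq_one_of_unipotent hΦ₀ huni hfix
    have hdec : absGaloisRestrict ℚ K σ₀ = i * (g * σ₁ * g⁻¹) := by rw [hi, inv_mul_cancel_right]
    constructor
    · rw [hdec, map_mul, hl1, one_mul, map_mul, map_mul, map_inv, mul_inv_cancel_comm]
    · rw [hdec, map_mul, hq1, one_mul, map_mul, map_mul, map_inv, mul_inv_cancel_comm]
  -- scalars of `σ₁` from the characters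
  have hχl_scalar : ∀ σ₁ : absoluteGaloisGroup ℚ, ∀ P ∈ Φ₀,
      σ₁ • P = (((χl σ₁ : (ZMod p)ˣ) : ZMod p).val) • P := fun σ₁ P hP ↦ by
    have h := smul_sub_zsmul_mem bot_stable hΦ₀.2 (relIndex_bot_line hΦ₀.1) σ₁
      (a := ((((χl σ₁ : (ZMod p)ˣ) : ZMod p).val : ℕ) : ℤ)) (by rw [Int.cast_natCast, ZMod.natCast_zmod_val]) hP
    rw [AddSubgroup.mem_bot, sub_eq_zero, natCast_zsmul] at h
    exact h
  have hχq_scalar : ∀ σ₁ : absoluteGaloisGroup ℚ, ∀ Q : geomTorsion W (p : ℤ),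
      σ₁ • Q - (((χq σ₁ : (ZMod p)ˣ) : ZMod p).val) • Q ∈ Φ₀ := fun σ₁ Q ↦ by
    have h := smul_sub_zsmul_mem hΦ₀.2 top_stable (relIndex_line_top hΦ₀.1) σ₁
      (a := ((((χq σ₁ : (ZMod p)ˣ) : ZMod p).val : ℕ) : ℤ)) (by rw [Int.cast_natCast, ZMod.natCast_zmod_val])
      (AddSubgroup.mem_top Q)
    rwa [natCast_zsmul] at h
  -- the relation at `σ₁`, moved to `res σ₀`
  obtain ⟨𝔓₁, h𝔓₁, σ₁, hσ₁, key⟩ := hD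
  obtain ⟨hcl, hcq⟩ := compare h𝔓₁ hσ₁
  have k := key hΦ₀ (hχl_scalar σ₁) (hχq_scalar σ₁)
  simp only [ZMod.natCast_zmod_val] at k
  rw [ha', hb', hcl, hcq]
  exact k

/-! ## §3 The scalars of a Frobenius above a multiplicative `ℓ ≠ p` on the residual pair, every prime `ℓ` -/

/-- **The residual pair of the good lattice at a Frobenius above a multiplicative `ℓ ≠ p` has scalars `{a_ℓ ℓ, a_ℓ}` —
EVERY prime `ℓ`.** `W/ℚ` globally minimal, `2 < p`, `Red`, `Anom`, (hlat), `K` imaginary quadratic with `p` split,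
`(θsub, θquot)` a residual pair over `K`, `ℓ ≠ p` multiplicative, `w ∋ ℓ` of residue degree one, `𝔓 ∣ w`, `σ₀` an
arithmetic Frobenius at `𝔓`: the integer scalars `a, b` of `σ₀` satisfy: split ⇒ `(ā, b̄) = (ℓ, 1)` or `(1, ℓ)`; non-split ⇒
`(−ℓ, −1)` or `(−1, −ℓ)`. The statement of -w2 g23's `…ScalarsAtMultiplicative.residualPair_frob_scalars_of_hasMultiplicativeReductionAtPrime`
WITHOUT its `ℓ ≠ 2` (§2 fed with -w2 g23's split engine and the every-`ℓ` non-split engine of §1).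
[cite: GreenbergVatsal2000, §2 pp. 14–15] [cite: CastellaGrossiLeeSkinner2022, Thm. 2.2.1 (a_ℓ ≡ φ(ℓ), ψ(ℓ) at ℓ ∥ N) and proof of Thm. 2.2.2 (eq:Euler-comp)]
[cite: KellerYin2024, §1.4 display (char to f) (arXiv:2402.12781v2 TeX L1066–1086)] [cite: Kriz2016, Thm. 34 (2)] -/
theorem residualPair_frob_scalars_of_hasMultiplicativeReductionAtPrime' (hp2 : 2 < p) (hred : Red W p)
    (hanom : Anom W p)
    (hlat : ∀ Φ : AddSubgroup (geomTorsion W (p : ℤ)), IsRationalLine W p Φ → ¬ LineUnramifiedAt W p Φ)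
    (hK : IsImaginaryQuadratic K) (hHp : SatisfiesHeegnerHypothesis p K)
    {θsub θquot : FramedGaloisRep K (padicCoeffIntegers S) 1} (h : IsResidualPairOver (W.baseChange K) p θsub θquot)
    {ℓ : ℕ} [hℓ : Fact ℓ.Prime] (hℓp : ℓ ≠ p) (hmult : W.HasMultiplicativeReductionAtPrime ℓ)
    {w : HeightOneSpectrum (𝓞 K)} (hw : ((ℓ : ℕ) : 𝓞 K) ∈ w.asIdeal) (hf : w.asIdeal.inertiaDeg (𝓞 ℚ) = 1)
    {𝔓 : Ideal (absIntegers (𝓞 K) K)} (h𝔓 : 𝔓 ∈ w.primesAbove) {σ₀ : absoluteGaloisGroup K}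
    (hσ₀ : IsArithFrobAt (𝓞 K) σ₀ 𝔓) :
    ∃ a b : ℤ,
      ‖((entry S θsub σ₀ : padicCoeffIntegers S) : PadicAlgCl p) - (a : PadicAlgCl p)‖ < 1 ∧
      ‖((entry S θquot σ₀ : padicCoeffIntegers S) : PadicAlgCl p) - (b : PadicAlgCl p)‖ < 1 ∧
      (W.HasSplitMultiplicativeReductionAtPrime ℓ →
        ((a : ZMod p) = (ℓ : ZMod p) ∧ (b : ZMod p) = 1) ∨ ((a : ZMod p) = 1 ∧ (b : ZMod p) = (ℓ : ZMod p))) ∧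
      (¬ W.HasSplitMultiplicativeReductionAtPrime ℓ →
        ((a : ZMod p) = -(ℓ : ZMod p) ∧ (b : ZMod p) = -1) ∨ ((a : ZMod p) = -1 ∧ (b : ZMod p) = -(ℓ : ZMod p))) := by
  -- the place `v ∋ ℓ` of `ℚ` below `w`
  let v : HeightOneSpectrum (𝓞 ℚ) := w.under (𝓞 ℚ)
  have hℓv : ((ℓ : ℕ) : 𝓞 ℚ) ∈ v.asIdeal := by
    change ((ℓ : ℕ) : 𝓞 ℚ) ∈ w.asIdeal.comap (algebraMap (𝓞 ℚ) (𝓞 K))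
    rw [Ideal.mem_comap, map_natCast]; exact hw
  have hvℓ : ((Rat.HeightOneSpectrum.primesEquiv v : Nat.Primes) : ℕ) = ℓ :=
    Rat.HeightOneSpectrum.primesEquiv_eq_of_natCast_mem v hℓ.out hℓv
  let D : ZMod p → ZMod p → Prop := fun x y ↦
    (W.HasSplitMultiplicativeReductionAtPrime ℓ → (x = (ℓ : ZMod p) ∧ y = 1) ∨ (x = 1 ∧ y = (ℓ : ZMod p))) ∧
    (¬ W.HasSplitMultiplicativeReductionAtPrime ℓ →
      (x = -(ℓ : ZMod p) ∧ y = -1) ∨ (x = -1 ∧ y = -(ℓ : ZMod p)))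
  have hD : ∃ 𝔓₁ ∈ v.primesAbove, ∃ σ₁ : absoluteGaloisGroup ℚ, IsArithFrobAt (𝓞 ℚ) σ₁ 𝔓₁ ∧
      ∀ {Φ₀ : AddSubgroup (geomTorsion W (p : ℤ))}, IsRationalLine W p Φ₀ →
      ∀ {nφ nψ : ℕ}, (∀ P ∈ Φ₀, σ₁ • P = nφ • P) →
        (∀ Q : geomTorsion W (p : ℤ), σ₁ • Q - nψ • Q ∈ Φ₀) → D (nφ : ZMod p) (nψ : ZMod p) := by
    by_cases hsplit : W.HasSplitMultiplicativeReductionAtPrime ℓ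
    · have hsplitv : W.HasSplitMultiplicativeReductionAt v := by
        refine (WeierstrassCurve.hasSplitMultiplicativeReductionAtPrime_iff_hasSplitMultiplicativeReductionAt W v).mp ?_
        have key : ∀ (q : ℕ) (hq' : Fact q.Prime), q = ℓ →
            (haveI := hq'; W.HasSplitMultiplicativeReductionAtPrime q) := by
          rintro q hq' rfl; exact hsplit
        exact key _ _ hvℓ
      obtain ⟨𝔓₁, h𝔓₁, σ₁, hσ₁, key⟩ :=
        LineScalarsAtMultiplicativePlace.exists_frob_lineScalars_of_hasSplitMultiplicativeReductionAt (W := W) hvℓ hℓp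
          hsplitv
      exact ⟨𝔓₁, h𝔓₁, σ₁, hσ₁, fun hΦ _ _ hφ hψ ↦ ⟨fun _ ↦ key hΦ hφ hψ, fun hns ↦ absurd hsplit hns⟩⟩
    · obtain ⟨𝔓₁, h𝔓₁, σ₁, hσ₁, key⟩ :=
        exists_frob_lineScalars_of_not_hasSplitMultiplicativeReductionAtPrime' (W := W) hvℓ hℓp hmult hsplit
      exact ⟨𝔓₁, h𝔓₁, σ₁, hσ₁, fun hΦ _ _ hφ hψ ↦ ⟨fun hsp ↦ absurd hsp hsplit, fun _ ↦ key hΦ hφ hψ⟩⟩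
  obtain ⟨a, b, ha, hb, hab⟩ :=
    residualPair_frob_scalars_of_lineScalars W K hp2 hred hanom hlat hK hHp h hℓp hmult hw hf h𝔓 hσ₀ D hD
  exact ⟨a, b, ha, hb, hab.1, hab.2⟩

end Transfer

end Summit.BirchSwinnertonDyer.BirchSwinnertonDyer.Theorems.GoodLatticeResidualPairScalarsAtMultiplicativeAll

end
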